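import Literature.AlgebraicGeometry.Resolution.PointBlowupAlgebraCharts
import Literature.AlgebraicGeometry.Motives.VarietiesProjectiveSpaceProofs
import Literature.AlgebraicGeometry.Motives.SegreEmbedding
import HarnessLib

/-!
# The projection `Bl₀ 𝔸ⁿ⁺¹ → ℙⁿ` on the charts: `(k[y]_{(yᵢ)})₀ → k[X][I/Xᵢ]`, `y_a/yᵢ ↦ X_a/Xᵢ`

Topic: `Literature/AlgebraicGeometry/Resolution`. Commutative algebra for the construction of
de Jong 1996, proof of Lemma 4.11 (p. 68) — the projection `q = pr_p : P̃ → ℙ^d` from the blow-up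
of `ℙ^{d+1}` in the vertex `p` ("`f` along `Eᵢ` looks like `pr_p : P̃^d → ℙ^{d-1}`"). On the
chart `Spec Cᵢ`, `Cᵢ = k[X₀, …, X_n][I/Xᵢ]` (`PointBlowupAlgebraCharts.lean`), of the blow-up of
`𝔸ⁿ⁺¹ = D₊(x_{n+1})` in the origin, the projection is `Spec` of the ring map
`(k[y₀, …, y_n]_{(yᵢ)})₀ → Cᵢ`, `y_a/yᵢ ↦ X_a/Xᵢ` — on homogeneous coordinates
`(x₀ : … : x_{n+1}) ↦ (x₀ : … : x_n) = (X₀ : … : X_n) = (X₀/Xᵢ : … : 1 : … : X_n/Xᵢ)`. PROVED: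

* `PointBlowup.awayBaseEquiv n k i : (k[y]_{(yᵢ)})₀ ≅ k[Y_a : a ≠ i]` — the dehomogenisation
  isomorphism `Motives.ProjectiveSpace.chartAlgEquiv` reindexed from `Fin n` to `{a // a ≠ i}`
  (`finSuccAboveEquiv`), with `y_a/yᵢ ↦ Y_a` (`awayBaseEquiv_frac`) and constants to constants;
* `PointBlowup.projRingHom n k i : (k[y]_{(yᵢ)})₀ → Cᵢ` — `awayBaseEquiv` followed by
  `βᵢ : Y_a ↦ X_a/Xᵢ` (`PointBlowup.baseHom`); **`projRingHom (y_a/yᵢ) = X_a/Xᵢ`**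
  (`projRingHom_frac`), it is a `k`-algebra map (`projRingHom_comp_cst`), and it is **smooth**
  (`smooth_projRingHom`: `βᵢ` is smooth, `PointBlowup.smooth_baseHom`, and `awayBaseEquiv` is an
  isomorphism) — the chart form of "`q : P̃ → ℙ^d` is smooth (a `ℙ¹`-bundle)".

No named facts; [folklore] throughout.

## Sources

* A. J. de Jong, *Smoothness, semi-stability and alterations*, Publ. Math. IHÉS 83 (1996),
  proof of Lemma 4.11, p. 68. [DeJong1996]
* R. Hartshorne, *Algebraic Geometry* (1977), I Thm. 3.4 (proof: `(k[x]_{(xᵢ)})₀ ≅ k[y]`),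
  II Prop. 2.5 (b). [Hartshorne1977]
-/

noncomputable section

open HomogeneousLocalization

attribute [local instance] MvPolynomial.gradedAlgebra
  Literature.AlgebraicGeometry.Motives.ProjBaseChange.algebraBase
  Literature.AlgebraicGeometry.Motives.ProjBaseChange.isScalarTower_localization

namespace Literature.AlgebraicGeometry.Resolution

universe u

open Literature.AlgebraicGeometry.Motives.Segre (grading cst X_mem val_cst val_frac)

namespace PointBlowup

variable (n : ℕ) (k : Type u) [Field k] (i : Fin (n + 1))

/-! ## `(k[y]_{(yᵢ)})₀ ≅ k[Y_a : a ≠ i]` -/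

/-- **`(k[y₀, …, y_n]_{(yᵢ)})₀ ≅ k[Y_a : a ≠ i]`, `y_a/yᵢ ↦ Y_a`**: the dehomogenisation isomorphism
`Motives.ProjectiveSpace.chartAlgEquiv` (onto `k[Y'₁, …, Y'_n]`, `y_{i.succAbove j}/yᵢ ↦ Y'_j`)
reindexed along `finSuccAboveEquiv i : Fin n ≃ {a // a ≠ i}`.
[cite: Hartshorne1977, I Thm. 3.4 (proof)] -/
def awayBaseEquiv : Away (grading (Fin (n + 1)) k) (MvPolynomial.X i) ≃+* Base n k i :=
  (Motives.ProjectiveSpace.chartAlgEquiv k i).toRingEquiv.trans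
    (MvPolynomial.renameEquiv k (finSuccAboveEquiv i)).toRingEquiv

/-- Segre's `y_a/yᵢ` at `a = i.succAbove j` is the `j`-th chart generator of
`Motives.ProjectiveSpace`. [folklore] -/
theorem frac_succAbove_eq_chartGen (j : Fin n) :
    Motives.Segre.frac k i (i.succAbove j) = Motives.ProjectiveSpace.chartGen k i j := by
  apply HomogeneousLocalization.val_injective
  rw [val_frac, Motives.ProjectiveSpace.val_chartGen, pow_one]

/-- `awayBaseEquiv (y_{i.succAbove j}/yᵢ) = Y_{i.succAbove j}`. [folklore] -/
theorem awayBaseEquiv_frac_succAbove (j : Fin n) :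
    awayBaseEquiv n k i (Motives.Segre.frac k i (i.succAbove j)) =
      MvPolynomial.X ⟨i.succAbove j, Fin.succAbove_ne i j⟩ := by
  rw [awayBaseEquiv, RingEquiv.trans_apply, frac_succAbove_eq_chartGen]
  change MvPolynomial.renameEquiv k (finSuccAboveEquiv i)
    (Motives.ProjectiveSpace.chartAlgEquiv k i (Motives.ProjectiveSpace.chartGen k i j)) = _
  rw [← Motives.ProjectiveSpace.chartAlgEquiv_symm_X, AlgEquiv.apply_symm_apply,
    MvPolynomial.renameEquiv_apply, MvPolynomial.rename_X, finSuccAboveEquiv_apply]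

/-- `awayBaseEquiv (y_a/yᵢ) = Y_a` for `a ≠ i`. [folklore] -/
theorem awayBaseEquiv_frac {a : Fin (n + 1)} (ha : a ≠ i) :
    awayBaseEquiv n k i (Motives.Segre.frac k i a) = MvPolynomial.X ⟨a, ha⟩ := by
  obtain ⟨j, rfl⟩ := Fin.exists_succAbove_eq ha
  exact awayBaseEquiv_frac_succAbove n k i j

/-- Segre's constants `cst` are the structure map of the `k`-algebra `(k[y]_{(yᵢ)})₀`
(`ProjBaseChange.algebraBase`). [folklore] -/
theorem cst_eq_algebraMap (c : k) :
    cst k (MvPolynomial.X i) c = algebraMap k (Away (grading (Fin (n + 1)) k) (MvPolynomial.X i)) c := by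
  apply HomogeneousLocalization.val_injective
  rw [val_cst, Motives.ProjBaseChange.val_algebraMap, IsScalarTower.algebraMap_apply k
    (MvPolynomial (Fin (n + 1)) k) (Localization.Away (MvPolynomial.X i : MvPolynomial (Fin (n + 1)) k)),
    MvPolynomial.algebraMap_eq]

/-- `awayBaseEquiv` on constants. [folklore] -/
theorem awayBaseEquiv_cst (c : k) : awayBaseEquiv n k i (cst k (MvPolynomial.X i) c) = MvPolynomial.C c := by
  rw [cst_eq_algebraMap, awayBaseEquiv, RingEquiv.trans_apply]
  change MvPolynomial.renameEquiv k (finSuccAboveEquiv i)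
    (Motives.ProjectiveSpace.chartAlgEquiv k i (algebraMap k _ c)) = _
  rw [AlgEquiv.commutes, MvPolynomial.algebraMap_eq, MvPolynomial.renameEquiv_apply,
    MvPolynomial.rename_C]

/-! ## The chart ring map of the projection -/

/-- **The chart ring map of the projection `q`**: `(k[y₀, …, y_n]_{(yᵢ)})₀ → Cᵢ = k[X][I/Xᵢ]`,
`y_a/yᵢ ↦ X_a/Xᵢ` (dehomogenise, then `βᵢ`). [cite: DeJong1996, Lemma 4.11 (proof), p. 68] -/
def projRingHom : Away (grading (Fin (n + 1)) k) (MvPolynomial.X i) →+* Chart n k i :=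
  (baseHom n k i).toRingHom.comp (awayBaseEquiv n k i).toRingHom

/-- **`projRingHom (y_a/yᵢ) = X_a/Xᵢ`** (for `a = i` both sides are `1`). [folklore] -/
theorem projRingHom_frac (a : Fin (n + 1)) :
    projRingHom n k i (Motives.Segre.frac k i a) = frac n k i a := by
  by_cases ha : a = i
  · subst ha
    rw [Motives.Segre.frac_self, map_one, PointBlowup.frac_self]
  · rw [projRingHom, RingHom.comp_apply, RingEquiv.toRingHom_eq_coe, RingEquiv.coe_toRingHom,
      awayBaseEquiv_frac n k i ha, AlgHom.toRingHom_eq_coe, RingHom.coe_coe, baseHom_X]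

/-- `projRingHom` is a `k`-algebra map: constants go to constants. [folklore] -/
theorem projRingHom_cst (c : k) : projRingHom n k i (cst k (MvPolynomial.X i) c) = algebraMap k (Chart n k i) c := by
  rw [projRingHom, RingHom.comp_apply, RingEquiv.toRingHom_eq_coe, RingEquiv.coe_toRingHom,
    awayBaseEquiv_cst, AlgHom.toRingHom_eq_coe, RingHom.coe_coe, baseHom_C]

/-- `projRingHom ∘ cst = algebraMap k Cᵢ`. [folklore] -/
theorem projRingHom_comp_cst :
    (projRingHom n k i).comp (cst k (MvPolynomial.X i)) = algebraMap k (Chart n k i) :=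
  RingHom.ext (projRingHom_cst n k i)

/-- **The chart ring map of the projection is smooth** (`βᵢ` is smooth and `awayBaseEquiv` is an
isomorphism): on the chart `Spec Cᵢ`, `q` is a smooth morphism to `D₊(yᵢ) ⊆ ℙⁿ`.
[cite: DeJong1996, Lemma 4.11 (proof), p. 68] -/
theorem smooth_projRingHom : (projRingHom n k i).Smooth :=
  RingHom.Smooth.comp (RingHom.Smooth.of_bijective (awayBaseEquiv n k i).bijective) (smooth_baseHom n k i)

end PointBlowup

end Literature.AlgebraicGeometry.Resolution

end
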